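import Mathlib
import Summits.ValiantsHypothesis.ValiantsHypothesis.Theorems.KPlusLogSqLawStepBetween

/-!
# Fine structure at the supremum of a separation set (static path model behind `KPlusLogSqLaw.TropicalB`)

Cell pub-symmetroid, seat conjb-2 (g21). A helper toward the crux `TropicalB`
(`Summit.ValiantsHypothesis.ValiantsHypothesis.Theses.KPlusLogSqLaw.TropicalB`, item
`stmt-ValiantsHypothesis-19771`); it earns no crux credit and is not evidence for `MatrixDescartes` or for
Valiant's hypothesis.

`KPlusLogSqLawStepBetween.step_between_core` runs the sup argument of THEORY-NOTE-g21 §3.1 and exports only its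
slope conclusion. The CONTINUATION LAW of THEORY-NOTE-g21 §3.1ter («a step away from the natural side of its row is
the last step of its plateau», kernel file `KPlusLogSqLawStepTerminal`) needs the fine structure itself, which this
file exports as `step_sup_structure`: for an arbitrary class `up` of upper lines with `i`, `i+d+1` upper, if
`[i, i+d]` and `[i+1, i+d+1]` are separated somewhere, never simultaneously, with `[i, i+d]` separating to the left,
then there are a real `r` (the supremum of the separation set `T` of `[i, i+d]`) and a non-upper inner line `o` of
`[i+1, i+d]` such that

* `s i < s o < s (i+d+1)` and the lines `i`, `o` meet at `r`;
* every comparison of `[i, i+d]` is `≥ 0` at `r`;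
* `T ≤ r`, and `T` has points above `r - ε` for every `ε > 0`;
* every separation point of `[i+1, i+d+1]` is STRICTLY to the right of `r`.

The proof is the one of `step_between_core` (same lemmas `affine_nonneg_at_csSup`, `affine_family_pos_nhds`), with
the last step replaced: a separation point of `[i+1, i+d+1]` at `r` itself would make `[i+1, i+d+1]` separated
near `r`, hence at points of `T`.
-/

set_option linter.dupNamespace false

namespace Summit.ValiantsHypothesis.ValiantsHypothesis.Theorems.KPlusLogSqLawStepSupStructure

open Finset
open Summit.ValiantsHypothesis.ValiantsHypothesis.Theorems.KPlusLogSqLawStepPair (affine_pos_of_ge)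
open Summit.ValiantsHypothesis.ValiantsHypothesis.Theorems.KPlusLogSqLawStepBetween
  (affine_nonneg_at_csSup affine_family_pos_nhds)

/-- Fine structure at the supremum of the left separation set of a step (see the module docstring). -/
theorem step_sup_structure (up : ℕ → Prop) (s b : ℕ → ℝ) (i d : ℕ) (hup0 : up i) (hup1 : up (i + d + 1))
    (hlow : ∃ o : ℕ, i + 1 ≤ o ∧ o ≤ i + d ∧ ¬ up o)
    (hA : ∃ θ : ℝ, ∀ e o : ℕ, i ≤ e → e ≤ i + d → i ≤ o → o ≤ i + d → up e → ¬ up o →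
      b o + s o * θ < b e + s e * θ)
    (hB : ∃ θ : ℝ, ∀ e o : ℕ, i + 1 ≤ e → e ≤ i + d + 1 → i + 1 ≤ o → o ≤ i + d + 1 → up e → ¬ up o →
      b o + s o * θ < b e + s e * θ)
    (hAB : ∀ θ : ℝ, ¬ ((∀ e o : ℕ, i ≤ e → e ≤ i + d → i ≤ o → o ≤ i + d → up e → ¬ up o →
      b o + s o * θ < b e + s e * θ) ∧ (∀ e o : ℕ, i + 1 ≤ e → e ≤ i + d + 1 → i + 1 ≤ o → o ≤ i + d + 1 →
      up e → ¬ up o → b o + s o * θ < b e + s e * θ)))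
    (hord : ∀ θ θ' : ℝ, (∀ e o : ℕ, i ≤ e → e ≤ i + d → i ≤ o → o ≤ i + d → up e → ¬ up o →
      b o + s o * θ < b e + s e * θ) → (∀ e o : ℕ, i + 1 ≤ e → e ≤ i + d + 1 → i + 1 ≤ o → o ≤ i + d + 1 →
      up e → ¬ up o → b o + s o * θ' < b e + s e * θ') → θ < θ') :
    ∃ (r : ℝ) (o : ℕ), i + 1 ≤ o ∧ o ≤ i + d ∧ ¬ up o ∧ s i < s o ∧ s o < s (i + d + 1) ∧
      b o + s o * r = b i + s i * r ∧
      (∀ e o' : ℕ, i ≤ e → e ≤ i + d → i ≤ o' → o' ≤ i + d → up e → ¬ up o' →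
        b o' + s o' * r ≤ b e + s e * r) ∧
      (∀ θ : ℝ, (∀ e o' : ℕ, i ≤ e → e ≤ i + d → i ≤ o' → o' ≤ i + d → up e → ¬ up o' →
        b o' + s o' * θ < b e + s e * θ) → θ ≤ r) ∧
      (∀ ε : ℝ, 0 < ε → ∃ θ : ℝ, (∀ e o' : ℕ, i ≤ e → e ≤ i + d → i ≤ o' → o' ≤ i + d → up e → ¬ up o' →
        b o' + s o' * θ < b e + s e * θ) ∧ r - ε < θ) ∧
      (∀ θ' : ℝ, (∀ e o' : ℕ, i + 1 ≤ e → e ≤ i + d + 1 → i + 1 ≤ o' → o' ≤ i + d + 1 → up e → ¬ up o' →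
        b o' + s o' * θ' < b e + s e * θ') → r < θ') := by
  classical
  obtain ⟨θA, hθA⟩ := hA
  obtain ⟨θB, hθB⟩ := hB
  set T : Set ℝ := {θ : ℝ | ∀ e o : ℕ, i ≤ e → e ≤ i + d → i ≤ o → o ≤ i + d → up e → ¬ up o →
      b o + s o * θ < b e + s e * θ} with hT
  have memT : ∀ θ : ℝ, θ ∈ T ↔ ∀ e o : ℕ, i ≤ e → e ≤ i + d → i ≤ o → o ≤ i + d → up e → ¬ up o →
      b o + s o * θ < b e + s e * θ := fun θ => Iff.rfl
  have hAT : θA ∈ T := (memT θA).2 hθA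
  have hne : T.Nonempty := ⟨θA, hAT⟩
  have hub : ∀ θ ∈ T, θ ≤ θB := fun θ hθ => le_of_lt (hord θ θB ((memT θ).1 hθ) hθB)
  have hbdd : BddAbove T := ⟨θB, hub⟩
  have hAle : θA ≤ sSup T := le_csSup hbdd hAT
  have hBge : sSup T ≤ θB := csSup_le hne hub
  -- Claim A: every comparison of `[i, i+d]` is `≥ 0` at `sSup T`
  have clA : ∀ e o : ℕ, i ≤ e → e ≤ i + d → i ≤ o → o ≤ i + d → up e → ¬ up o →
      b o + s o * sSup T ≤ b e + s e * sSup T := by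
    intro e o h1 h2 h3 h4 he ho
    have := affine_nonneg_at_csSup T hne hbdd (b e - b o) (s e - s o) (fun θ hθ => by
      have := (memT θ).1 hθ e o h1 h2 h3 h4 he ho
      linarith)
    linarith
  -- an affine function vanishing at `sSup T`, positive at `θA ≤ sSup T` and at `θB ≥ sSup T` is impossible
  have novanish : ∀ fa fb : ℝ, 0 < fa + fb * θA → 0 < fa + fb * θB → fa + fb * sSup T = 0 → False := by
    intro fa fb hxa hxb h0
    by_cases hm : 0 ≤ fb
    · have p : 0 ≤ fb * (sSup T - θA) := mul_nonneg hm (by linarith)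
      have i1 : fa + fb * θA = (fa + fb * sSup T) - fb * (sSup T - θA) := by ring
      linarith
    · have hm' : fb < 0 := not_le.mp hm
      have p : 0 ≤ (-fb) * (θB - sSup T) := mul_nonneg (by linarith) (by linarith)
      have i1 : fa + fb * θB = (fa + fb * sSup T) - (-fb) * (θB - sSup T) := by ring
      linarith
  -- Claim B1: inner comparisons (upper line `≠ i`) are `> 0` at `sSup T`
  have clB1 : ∀ e o : ℕ, i + 1 ≤ e → e ≤ i + d → i ≤ o → o ≤ i + d → up e → ¬ up o →
      b o + s o * sSup T < b e + s e * sSup T := by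
    intro e o h1 h2 h3 h4 he ho
    have hoi : o ≠ i := fun h => ho (h ▸ hup0)
    rcases lt_or_eq_of_le (clA e o (by omega) h2 h3 h4 he ho) with hlt | heq
    · exact hlt
    · exfalso
      have dA := hθA e o (by omega) h2 h3 h4 he ho
      have dB := hθB e o h1 (by omega) (by omega) (by omega) he ho
      exact novanish (b e - b o) (s e - s o) (by linarith) (by linarith) (by linarith)
  -- Claim B2: some comparison through the line `i` vanishes at `sSup T`
  have clB2 : ∃ o : ℕ, i + 1 ≤ o ∧ o ≤ i + d ∧ ¬ up o ∧ b o + s o * sSup T = b i + s i * sSup T := by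
    by_contra hnot
    -- then every comparison of `[i, i+d]` is `> 0` at `sSup T`
    have hall : ∀ e o : ℕ, i ≤ e → e ≤ i + d → i ≤ o → o ≤ i + d → up e → ¬ up o →
        b o + s o * sSup T < b e + s e * sSup T := by
      intro e o h1 h2 h3 h4 he ho
      have hoi : o ≠ i := fun h => ho (h ▸ hup0)
      by_cases hei : e = i
      · subst hei
        rcases lt_or_eq_of_le (clA e o h1 h2 h3 h4 he ho) with hlt | heq
        · exact hlt
        · exact absurd ⟨o, by omega, h4, ho, heq⟩ hnot
      · exact clB1 e o (by omega) h2 h3 h4 he ho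
    -- positivity on a neighbourhood of `sSup T`
    set PA : Finset (ℕ × ℕ) := ((Icc i (i + d)) ×ˢ (Icc i (i + d))).filter (fun p => up p.1 ∧ ¬ up p.2)
      with hPA
    have memA : ∀ p : ℕ × ℕ, p ∈ PA ↔
        ((i ≤ p.1 ∧ p.1 ≤ i + d) ∧ (i ≤ p.2 ∧ p.2 ≤ i + d)) ∧ (up p.1 ∧ ¬ up p.2) := by
      intro p
      simp only [hPA, Finset.mem_filter, Finset.mem_product, Finset.mem_Icc]
    obtain ⟨ε, hε, hfam⟩ := affine_family_pos_nhds PA (fun p => b p.1 - b p.2) (fun p => s p.1 - s p.2)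
      (sSup T) (by
        intro c hc
        obtain ⟨⟨⟨h1, h2⟩, ⟨h3, h4⟩⟩, ⟨he, ho⟩⟩ := (memA c).1 hc
        have := hall c.1 c.2 h1 h2 h3 h4 he ho
        linarith)
    have hmem : sSup T + ε ∈ T := by
      rw [memT]
      intro e o h1 h2 h3 h4 he ho
      have := hfam (e, o) ((memA (e, o)).2 ⟨⟨⟨h1, h2⟩, ⟨h3, h4⟩⟩, ⟨he, ho⟩⟩) (sSup T + ε)
        (by linarith) (le_refl _)
      simp only at this
      linarith
    have := le_csSup hbdd hmem
    linarith
  obtain ⟨o, ho1, ho2, hou, hoeq⟩ := clB2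
  have hoi : o ≠ i := fun h => hou (h ▸ hup0)
  -- Claim B3: `s i < s o`
  have clB3 : s i < s o := by
    by_contra hge
    have hge' : 0 ≤ s i - s o := by linarith [not_lt.mp hge]
    have dA := hθA i o (le_refl _) (by omega) (by omega) ho2 hup0 hou
    have p : 0 ≤ (s i - s o) * (sSup T - θA) := mul_nonneg hge' (by linarith)
    have i1 : (b i - b o) + (s i - s o) * θA
        = ((b i - b o) + (s i - s o) * sSup T) - (s i - s o) * (sSup T - θA) := by ring
    linarith

  -- no separation point of `[i+1, i+d+1]` AT `sSup T`: it would propagate to points of `T` just below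
  have noBsep : ¬ (∀ e o' : ℕ, i + 1 ≤ e → e ≤ i + d + 1 → i + 1 ≤ o' → o' ≤ i + d + 1 → up e → ¬ up o' →
      b o' + s o' * sSup T < b e + s e * sSup T) := by
    intro hallB
    set PB : Finset (ℕ × ℕ) :=
      ((Icc (i + 1) (i + d + 1)) ×ˢ (Icc (i + 1) (i + d + 1))).filter (fun p => up p.1 ∧ ¬ up p.2) with hPB
    have memB : ∀ p : ℕ × ℕ, p ∈ PB ↔
        ((i + 1 ≤ p.1 ∧ p.1 ≤ i + d + 1) ∧ (i + 1 ≤ p.2 ∧ p.2 ≤ i + d + 1)) ∧ (up p.1 ∧ ¬ up p.2) := by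
      intro p
      simp only [hPB, Finset.mem_filter, Finset.mem_product, Finset.mem_Icc]
    obtain ⟨ε, hε, hfam⟩ := affine_family_pos_nhds PB (fun p => b p.1 - b p.2) (fun p => s p.1 - s p.2)
      (sSup T) (by
        intro c hc
        obtain ⟨⟨⟨h1, h2⟩, ⟨h3, h4⟩⟩, ⟨he, ho'⟩⟩ := (memB c).1 hc
        have := hallB c.1 c.2 h1 h2 h3 h4 he ho'
        linarith)
    obtain ⟨θ, hθT, hθ⟩ := exists_lt_of_lt_csSup hne (show sSup T - ε < sSup T by linarith)
    have hθle : θ ≤ sSup T := le_csSup hbdd hθT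
    apply hAB θ
    refine ⟨(memT θ).1 hθT, ?_⟩
    intro e o' h1 h2 h3 h4 he ho'
    have := hfam (e, o') ((memB (e, o')).2 ⟨⟨⟨h1, h2⟩, ⟨h3, h4⟩⟩, ⟨he, ho'⟩⟩) θ (by linarith) (by linarith)
    simp only at this
    linarith
  -- Claim B4: `s o < s (i+d+1)` (else `[i+1, i+d+1]` would be separated at `sSup T`)
  have clB4 : s o < s (i + d + 1) := by
    by_contra hge
    have hle : s (i + d + 1) - s o ≤ 0 := by linarith [not_lt.mp hge]
    have dB := hθB (i + d + 1) o (by omega) (le_refl _) ho1 (by omega) hup1 hou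
    have eR : 0 < (b (i + d + 1) - b o) + (s (i + d + 1) - s o) * sSup T :=
      affine_pos_of_ge θB (sSup T) (b (i + d + 1) - b o) (s (i + d + 1) - s o) (by linarith) hle hBge
    apply noBsep
    intro e o' h1 h2 h3 h4 he ho'
    have ho'top : o' ≠ i + d + 1 := fun h => ho' (h ▸ hup1)
    by_cases hetop : e = i + d + 1
    · subst hetop
      have := clA i o' (le_refl _) (by omega) (by omega) (by omega) hup0 ho'
      linarith
    · exact clB1 e o' h1 (by omega) (by omega) (by omega) he ho'
  refine ⟨sSup T, o, ho1, ho2, hou, clB3, clB4, hoeq, ?_, ?_, ?_, ?_⟩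
  · intro e o' h1 h2 h3 h4 he ho'
    exact clA e o' h1 h2 h3 h4 he ho'
  · intro θ hθ
    exact le_csSup hbdd ((memT θ).2 hθ)
  · intro ε hε
    obtain ⟨θ, hθT, hθ⟩ := exists_lt_of_lt_csSup hne (show sSup T - ε < sSup T by linarith)
    exact ⟨θ, (memT θ).1 hθT, hθ⟩
  · -- a separation point of `[i+1, i+d+1]` lies strictly to the right of `sSup T`
    intro θ' hθ'
    have hge : sSup T ≤ θ' := csSup_le hne (fun θ hθ => le_of_lt (hord θ θ' ((memT θ).1 hθ) hθ'))
    rcases lt_or_eq_of_le hge with hlt | heq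
    · exact hlt
    · exfalso
      apply noBsep
      intro e o'' h1 h2 h3 h4 he ho''
      have := hθ' e o'' h1 h2 h3 h4 he ho''
      rw [← heq] at this
      exact this

end Summit.ValiantsHypothesis.ValiantsHypothesis.Theorems.KPlusLogSqLawStepSupStructure
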